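import Summits.ABC.IUTFork.Thm311RealInd1StripTwistLattice
import Summits.ABC.IUTFork.Thm311RealInd1Strip
import Literature.NumberTheory.GaloisRepresentations.UniformizerResidueIndex
import Literature.IUT.LogVolume.RescaledCompletionInvariants
import HarnessLib

/-!
# [IUTchIII] Thm 3.11 (i) (Ind1) at `v ∈ 𝕍^non`: a Jannsen–Wingberg TWIST PAIR realised in print's strip part MOVES
# a closed ball of `K_v` as soon as `f(v|p) = 1` — the R9f open point has a NEGATIVE answer there

PROOF-ONLY file (abc-iut cell, Cor. 3.12 sub-crew, seat abc-iut-c312-1 = holder of record of the typed [IUTchIII]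
Thm. 3.11, gen 9; row «R10 IND1-STRIP-MOVER-JW»).  TAKES NO SIDE on [IUTchIII] Cor. 3.12.

THE OPEN POINT (my lineage's `Thm311RealInd1StripLattices`, p456209, docstring «does THE units transport of an
arbitrary `φ ∈ Aut_top(G_v)` preserve `μ·U_v^(m)`?»; equivalently: does every element of print's (Ind1) strip part
`Real.ind1StripOf v L` map every closed ball `𝔪_v^m` of `K_v` onto itself, as print's (Ind2) does —
`Thm311RealInd2IsmIsometry.image_closedBall_eq_of_mem_ismIsm` — and as Dupuy–Hilado's (Ind1) `= {1}` trivially does?).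

THE NON-ABELIAN INPUT (read on the page; NOT asserted here — it enters as BINDERS, see HONEST SCOPE).  For `p` odd and
`d = [K_v : ℚ_p] ≥ 3`, Jannsen–Wingberg's presentation of `G_v` (Neukirch–Schmidt–Wingberg, *Cohomology of Number
Fields*, Thm. 7.5.14: generators `σ, τ, x_0, …, x_d`, one relation containing the product of commutators
`[x_3,x_4]⋯[x_{d−1},x_d]`) has «Dehn twist» automorphisms — K. Kondo, *Anabelian aspects of the outer automorphism
groups of the absolute Galois groups of mixed-characteristic local fields*, arXiv:2512.09231 (2025), §2, proof of
Thm. 2.3 p. 10: `φ_i : b_i ↦ b_i a_i`, `φ'_i : a_i ↦ a_i b_i⁻¹` (all other generators fixed) — whose induced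
automorphisms of `(K_v)_+` through `G_v^{ab} ≅ K_v^×^ ⊇ 𝒪_v^×` and `log` (= OUR `liftUnits v φ` read through `L`, the
«mono-anabelian transport») are the ELEMENTARY TRANSVECTIONS `y_b ↦ y_b + y_a`, `y_a ↦ y_a − y_b` of a `ℚ_p`-basis
`y_j = log(rec⁻¹ x̄_j)` of `(K_v)_+` (Hoshi–Nishio, Res. Number Theory 8 (2022), Lemma 1.3; Kondo, loc. cit.,
`(φ_i)_+(v) − v = e_i y_{2i+1}`, `(φ'_i)_+(v) − v = −c_i y_{2i+2}`).

THIS FILE (every constant a landed tree decl; no `Prop` fact, no definition):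
* §1 (any locally compact ultrametric normed `ℚ_p`-algebra field `K`, uniformizer `ϖ`): the closed balls
  `B_m := ϖ^m 𝒪 = B(0, ‖ϖ‖^m)` (`m ∈ ℤ`, the tree's `piBall (ϖ ^ m)`) form a chain with consecutive index
  `[B_m : B_{m+1}] = #(𝒪/𝔪)` (`relIndex_piBall_zpow_succ`, from the tree's `IsUniformizer.resIndex_eq_card_residueField` by
  translation) and `B_{m+e} = p • B_m`, `e = absRamificationIdx` (`exists_mem_piBall_eq_prime_smul`);
* §2 **`not_forall_twistStable_piBall`**: if `#(𝒪/𝔪)` is PRIME (`f = 1`) then for NO twist pair `(ya, yb; ca, cb)`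
  (`ca ya = cb yb = 1`, `ca yb = cb ya = 0`, `ca cb : K →ₗ[ℚ_p] ℚ_p`) are all the balls `B_m` stable under both
  transvections `v ↦ v + cb v • ya`, `v ↦ v − ca v • yb` — by the lattice lemma of `Thm311RealInd1StripTwistLattice`
  (`inv_mul_smul_ya_mem_of_chain`: the `ya`-coefficients of `B_k ∋ ya` would be `p⁻¹`-divisible, but
  `‖p⁻¹ • ya‖ > ‖ya‖ = ‖ϖ‖^k`); hence (`exists_transvection_moves_piBall`) SOME ball is moved by one of the two;
* §3 **AT THE REAL LOG-SHELL** (`K_v`, `v` a finite place of the number field `F` over `p` with `f(v|p) = 1`, read in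
  abc-iut-S7's rescaled norm `RescaledCompletion F p v hv`, `#(𝒪_v/𝔪_v) = p^{f(v|p)}` by abc-iut-S1/S7):
  **`Real.exists_mem_ind1StripOf_image_closedBall_ne`** — if two elements `ψ, ψ'` of print's (Ind1) strip part
  `Real.ind1StripOf v L` act on `K_v` as such a transvection pair (BINDERS: this is exactly what the Jannsen–Wingberg
  twists supply when `p` is odd and `[K_v : ℚ_p] = e(v|p) ≥ 3`), then some `χ ∈ Real.ind1StripOf v L` and some radius
  `‖ϖ‖^m` have `χ(B(0,‖ϖ‖^m)) ≠ B(0,‖ϖ‖^m)`: print's (Ind1) strip part MOVES an ideal-shaped region — in contrast with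
  print's (Ind2) (`image_closedBall_eq_of_mem_ismIsm`: moves no ball) and with the unramified case (Y. Hoshi, *Topics
  in the anabelian geometry of mixed-characteristic local fields*, Hiroshima Math. J. 49 (2019), §2 Prop. 2.10:
  `𝔪_k^n ⊆ k_+` is group-theoretically reconstructible when `e = 1`, `p` odd).

HONEST SCOPE.  The realisation of the twist pair inside `Real.ind1StripOf v L` is a HYPOTHESIS of §3 (binders
`hψ, hψ', hT, hT'`), i.e. this file proves «twist pair realised ⟹ mover», not the existence of the twists; that
existence is classical (NSW Thm. 7.5.14 + Kondo §2) and is filed separately as a named Literature fact to be bridged to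
`liftUnits` through the tree's reciprocity transport (`Cor110iiPrime.exists_theta_unitsTransport`).  A statement about
OUR typed objects at ONE place; nothing here asserts or refutes [IUTchIII] Cor. 3.12.  [claim: Mochizuki2012, status:
disputed] for every [IUTchIII] quotation; [cite: NeukirchSchmidtWingberg2008, Thm 7.5.14]; [cite: DupuyHilado2025, §4.7].
typed ≠ proved.
-/

set_option autoImplicit false

noncomputable section

open Metric Set
open scoped Pointwise

namespace Summit.ABC.IUTFork.Thm311.TwistLattice

open Literature.NumberTheory.GaloisRepresentations.Ultrametric Literature.IUT.LogVolume

/-! ## 1. The chain of closed balls `B_m = ϖ^m 𝒪` of a local field: consecutive index `#(𝒪/𝔪)`, `B_{m+e} = p • B_m` -/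

section Balls

variable {K : Type*} [NontriviallyNormedField K] [IsUltrametricDist K]

/-- Membership in the additive subgroup `w𝒪 = B(0, ‖w‖)` underlying the tree's `piBall w`. [folklore] -/
theorem mem_toAddSubgroup_piBall {w : Kˣ} {x : K} :
    x ∈ (piBall w : OpenAddSubgroup K).toAddSubgroup ↔ ‖x‖ ≤ ‖(w : K)‖ :=
  mem_piBall

/-- Translation of balls: `u • B(0,‖w‖) = B(0, ‖u w‖)`, as additive subgroups
(`map (x ↦ u x) (piBall w) = piBall (u * w)`). [folklore] -/
theorem map_mulLeft_piBall (u w : Kˣ) :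
    ((piBall w : OpenAddSubgroup K).toAddSubgroup).map (AddMonoidHom.mulLeft (u : K)) =
      (piBall (u * w) : OpenAddSubgroup K).toAddSubgroup := by
  ext x
  simp only [AddSubgroup.mem_map, mem_toAddSubgroup_piBall, AddMonoidHom.coe_mulLeft, Units.val_mul, norm_mul]
  constructor
  · rintro ⟨y, hy, rfl⟩
    rw [norm_mul]
    exact mul_le_mul_of_nonneg_left hy (norm_nonneg _)
  · intro hx
    refine ⟨(u : K)⁻¹ * x, ?_, by rw [← mul_assoc, mul_inv_cancel₀ u.ne_zero, one_mul]⟩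
    rw [norm_mul, norm_inv]
    have hu : 0 < ‖(u : K)‖ := norm_pos_iff.mpr u.ne_zero
    rw [inv_mul_le_iff₀ hu]
    exact hx

/-- `piBall 1 = 𝒪` (the tree's `unitBall`). [folklore] -/
theorem piBall_one_eq_unitBall : (piBall (1 : Kˣ) : OpenAddSubgroup K).toAddSubgroup = (unitBall K).toAddSubgroup := by
  ext x
  rw [mem_toAddSubgroup_piBall, Units.val_one, norm_one]
  exact mem_unitBall.symm

/-- **Consecutive index of the ball chain**: `[ϖ^m 𝒪 : ϖ^{m+1} 𝒪] = [𝒪 : ϖ𝒪] = resIndex ϖ` for every `m ∈ ℤ`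
(translate by `ϖ^m`). [folklore] -/
theorem relIndex_piBall_zpow_succ (ϖ : Kˣ) (m : ℤ) :
    ((piBall (ϖ ^ (m + 1)) : OpenAddSubgroup K).toAddSubgroup).relIndex
        (piBall (ϖ ^ m) : OpenAddSubgroup K).toAddSubgroup = resIndex ϖ := by
  have hinj : Function.Injective (AddMonoidHom.mulLeft ((ϖ ^ m : Kˣ) : K)) :=
    fun a b h => mul_left_cancel₀ (ϖ ^ m).ne_zero h
  rw [show ϖ ^ (m + 1) = ϖ ^ m * ϖ from zpow_add_one ϖ m, ← map_mulLeft_piBall,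
    show (piBall (ϖ ^ m) : OpenAddSubgroup K).toAddSubgroup =
      ((piBall (1 : Kˣ) : OpenAddSubgroup K).toAddSubgroup).map (AddMonoidHom.mulLeft ((ϖ ^ m : Kˣ) : K)) by
      rw [map_mulLeft_piBall, mul_one],
    AddSubgroup.relIndex_map_map_of_injective _ _ hinj, piBall_one_eq_unitBall]
  rfl

/-- The chain decreases: `ϖ^{m+1} 𝒪 ≤ ϖ^m 𝒪` when `‖ϖ‖ ≤ 1`. [folklore] -/
theorem piBall_zpow_succ_le {ϖ : Kˣ} (hϖ : ‖(ϖ : K)‖ ≤ 1) (m : ℤ) :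
    (piBall (ϖ ^ (m + 1)) : OpenAddSubgroup K).toAddSubgroup ≤ (piBall (ϖ ^ m) : OpenAddSubgroup K).toAddSubgroup := by
  intro x hx
  rw [mem_toAddSubgroup_piBall] at hx ⊢
  refine hx.trans ?_
  rw [zpow_add_one, Units.val_mul, norm_mul]
  exact mul_le_of_le_one_right (norm_nonneg _) hϖ

variable (p : ℕ) [Fact p.Prime] [NormedAlgebra ℚ_[p] K] [ProperSpace K]

/-- **`B_{m+e} = p • B_m`** with `e = absRamificationIdx p K` (`‖p‖ = ‖ϖ‖^e`, abc-iut-S1's `norm_prime_eq_norm_pow`):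
every `w` with `‖w‖ ≤ ‖ϖ‖^{m+e}` is `p • u` with `‖u‖ ≤ ‖ϖ‖^m`. [folklore] -/
theorem exists_mem_piBall_eq_prime_smul {ϖ : Kˣ} (hϖ : IsUniformizer ϖ) (m : ℤ) (w : K)
    (hw : w ∈ (piBall (ϖ ^ (m + absRamificationIdx p K)) : OpenAddSubgroup K).toAddSubgroup) :
    ∃ u ∈ (piBall (ϖ ^ m) : OpenAddSubgroup K).toAddSubgroup, w = (p : ℚ_[p]) • u := by
  have hp0 : (p : K) ≠ 0 := prime_ne_zero p K
  refine ⟨(p : K)⁻¹ * w, ?_, ?_⟩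
  · rw [mem_toAddSubgroup_piBall] at hw ⊢
    rw [norm_mul, norm_inv, norm_prime_eq_norm_pow p K hϖ, Units.val_zpow_eq_zpow_val, norm_zpow]
    rw [Units.val_zpow_eq_zpow_val, norm_zpow, zpow_add₀ (norm_ne_zero_iff.mpr ϖ.ne_zero), zpow_natCast] at hw
    have hpos : 0 < ‖(ϖ : K)‖ ^ absRamificationIdx p K := pow_pos (norm_pos_iff.mpr ϖ.ne_zero) _
    rw [inv_mul_le_iff₀ hpos, mul_comm]
    exact hw
  · rw [Algebra.smul_def, map_natCast, ← mul_assoc, mul_inv_cancel₀ hp0, one_mul]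

end Balls

/-! ## 2. No twist pair stabilises all the balls when `#(𝒪/𝔪)` is prime -/

section NoTwist

variable (p : ℕ) [Fact p.Prime] {K : Type*} [NontriviallyNormedField K] [NormedAlgebra ℚ_[p] K]
  [IsUltrametricDist K] [ProperSpace K]

open scoped NormedField in
/-- **No twist pair stabilises the whole ball chain (`f = 1`).**  If the residue field `𝒪/𝔪` of `K` has PRIME
cardinality, `ϖ` is a uniformizer and `(ya, yb; ca, cb)` is a twist pair of `K` over `ℚ_p` (`ca ya = cb yb = 1`,
`ca yb = cb ya = 0`), then NOT every ball `ϖ^m 𝒪` (`m ∈ ℤ`) is stable under both transvections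
`v ↦ v + cb v • ya` and `v ↦ v − ca v • yb`.  (Else, with `‖ya‖ = ‖ϖ‖^k`, the chain `B_k ≥ ⋯ ≥ B_{k+e} = p • B_k`
of prime steps forces `p⁻¹ • ya ∈ B_k` by `inv_mul_smul_ya_mem_of_chain`, but `‖p⁻¹ • ya‖ > ‖ya‖`.)
[cite: NeukirchSchmidtWingberg2008, Thm 7.5.14] -/
theorem not_forall_twistStable_piBall (hprime : (Nat.card (IsLocalRing.ResidueField (Valued.integer K))).Prime)
    {ϖ : Kˣ} (hϖ : IsUniformizer ϖ) {ca cb : K →ₗ[ℚ_[p]] ℚ_[p]} {ya yb : K}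
    (hca : ca ya = 1) (hcb : cb yb = 1) (hba : cb ya = 0) :
    ¬ ∀ m : ℤ, (∀ v ∈ (piBall (ϖ ^ m) : OpenAddSubgroup K).toAddSubgroup,
          v + cb v • ya ∈ (piBall (ϖ ^ m) : OpenAddSubgroup K).toAddSubgroup) ∧
        (∀ v ∈ (piBall (ϖ ^ m) : OpenAddSubgroup K).toAddSubgroup,
          v - ca v • yb ∈ (piBall (ϖ ^ m) : OpenAddSubgroup K).toAddSubgroup) := by
  intro hall
  -- `ya ≠ 0`, so `‖ya‖ = ‖ϖ‖^k` for some `k ∈ ℤ`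
  have hya0 : ya ≠ 0 := by
    intro h; rw [h, map_zero] at hca; exact zero_ne_one hca
  obtain ⟨k, hk⟩ := hϖ.2 (Units.mk0 ya hya0)
  rw [Units.val_mk0] at hk
  -- the chain `Λ j := B_{k+j}`, `j = 0, …, e`
  set e := absRamificationIdx p K with he
  let Λ : ℕ → AddSubgroup K := fun j => (piBall (ϖ ^ (k + (j : ℤ))) : OpenAddSubgroup K).toAddSubgroup
  have hΛ : ∀ j : ℕ, Λ j = (piBall (ϖ ^ (k + (j : ℤ))) : OpenAddSubgroup K).toAddSubgroup := fun _ => rfl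
  have hanti : ∀ j < e, Λ (j + 1) ≤ Λ j := by
    intro j _
    rw [hΛ, hΛ, Nat.cast_succ, ← add_assoc]
    exact piBall_zpow_succ_le hϖ.1.le _
  have hst : ∀ j ≤ e, (∀ v ∈ Λ j, v + cb v • ya ∈ Λ j) ∧ (∀ v ∈ Λ j, v - ca v • yb ∈ Λ j) := fun j _ => hall _
  have hidx : ∀ j < e, (Λ (j + 1)).relIndex (Λ j) = Nat.card (IsLocalRing.ResidueField (Valued.integer K)) := by
    intro j _
    rw [hΛ, hΛ, Nat.cast_succ, ← add_assoc, relIndex_piBall_zpow_succ, hϖ.resIndex_eq_card_residueField]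
  have hp0 : (p : ℚ_[p]) ≠ 0 := Nat.cast_ne_zero.mpr (Fact.out : p.Prime).ne_zero
  have htop : ∀ w, w ∈ Λ e → ∃ u ∈ Λ 0, w = (p : ℚ_[p]) • u := by
    intro w hw
    rw [hΛ] at hw
    have h := exists_mem_piBall_eq_prime_smul p hϖ k w hw
    simpa only [hΛ, Nat.cast_zero, add_zero] using h
  have hr : (1 : ℚ_[p]) • ya ∈ Λ 0 := by
    rw [one_smul, hΛ, mem_toAddSubgroup_piBall, Nat.cast_zero, add_zero, hk, Units.val_zpow_eq_zpow_val, norm_zpow]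
  have h := inv_mul_smul_ya_mem_of_chain (ca := ca) (cb := cb) (ya := ya) (yb := yb) hca hcb hba Λ e hanti hst
    (fun _ => Nat.card (IsLocalRing.ResidueField (Valued.integer K))) (fun _ _ => hprime) hidx hp0 htop hr
  rw [mul_one, hΛ, mem_toAddSubgroup_piBall, Nat.cast_zero, add_zero, Units.val_zpow_eq_zpow_val, norm_zpow, ← hk,
    norm_smul, norm_inv] at h
  -- `‖p‖⁻¹ · ‖ya‖ ≤ ‖ya‖` contradicts `‖p‖ < 1`, `ya ≠ 0`
  have hya : 0 < ‖ya‖ := norm_pos_iff.mpr hya0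
  have hpn : ‖(p : ℚ_[p])‖ < 1 := by
    rw [Padic.norm_p]; exact inv_lt_one_of_one_lt₀ (by exact_mod_cast (Fact.out : p.Prime).one_lt)
  have hpn0 : 0 < ‖(p : ℚ_[p])‖ := norm_pos_iff.mpr hp0
  have : ‖ya‖ < ‖(p : ℚ_[p])‖⁻¹ * ‖ya‖ := by
    rw [lt_inv_mul_iff₀ hpn0]
    calc ‖(p : ℚ_[p])‖ * ‖ya‖ < 1 * ‖ya‖ := mul_lt_mul_of_pos_right hpn hya
      _ = ‖ya‖ := one_mul _
  exact absurd h (not_le.mpr this)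

open scoped NormedField in
/-- **Hence SOME ball is MOVED by one of the two transvections** (if a map sends every `B_m` into itself and so does
the other, all balls are stable). [cite: NeukirchSchmidtWingberg2008, Thm 7.5.14] -/
theorem exists_transvection_image_piBall_ne (hprime : (Nat.card (IsLocalRing.ResidueField (Valued.integer K))).Prime)
    {ϖ : Kˣ} (hϖ : IsUniformizer ϖ) {ca cb : K →ₗ[ℚ_[p]] ℚ_[p]} {ya yb : K}
    (hca : ca ya = 1) (hcb : cb yb = 1) (hba : cb ya = 0) (T T' : K → K)
    (hT : ∀ v, T v = v + cb v • ya) (hT' : ∀ v, T' v = v - ca v • yb) :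
    ∃ m : ℤ, T '' closedBall (0 : K) (‖(ϖ : K)‖ ^ m) ≠ closedBall (0 : K) (‖(ϖ : K)‖ ^ m) ∨
      T' '' closedBall (0 : K) (‖(ϖ : K)‖ ^ m) ≠ closedBall (0 : K) (‖(ϖ : K)‖ ^ m) := by
  by_contra hcon
  push Not at hcon
  apply not_forall_twistStable_piBall p hprime hϖ hca hcb hba
  intro m
  obtain ⟨h1, h2⟩ := hcon m
  have hball : ∀ x : K, x ∈ (piBall (ϖ ^ m) : OpenAddSubgroup K).toAddSubgroup ↔
      x ∈ closedBall (0 : K) (‖(ϖ : K)‖ ^ m) := by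
    intro x
    rw [mem_toAddSubgroup_piBall, mem_closedBall_zero_iff, Units.val_zpow_eq_zpow_val, norm_zpow]
  refine ⟨fun v hv => ?_, fun v hv => ?_⟩
  · rw [hball] at hv ⊢
    rw [← hT, ← h1]
    exact Set.mem_image_of_mem T hv
  · rw [hball] at hv ⊢
    rw [← hT', ← h2]
    exact Set.mem_image_of_mem T' hv

end NoTwist

end Summit.ABC.IUTFork.Thm311.TwistLattice

/-! ## 3. At the real log-shell `K_v`: a twist pair inside print's (Ind1) strip part moves a ball -/

namespace Summit.ABC.IUTFork.Thm311.Real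

open NumberField IsDedekindDomain Literature.NumberTheory.NumberFields Literature.IUT.LogVolume
open Literature.NumberTheory.GaloisRepresentations.Ultrametric Summit.ABC.IUTFork.Thm311.TwistLattice

variable {F : Type} [Field F] [NumberField F] (p : ℕ) [Fact p.Prime] (v : HeightOneSpectrum (𝓞 F))
  (hv : ((p : ℕ) : 𝓞 F) ∈ v.asIdeal)

/-- **PRINT'S (Ind1) STRIP PART MOVES A BALL once it realises a twist pair, at `f(v|p) = 1`.**  Let `v ∣ p` be a finite
place of `F` with `f(v|p) = 1`, read `K_v` in abc-iut-S7's rescaled norm (`K := RescaledCompletion F p v hv`, the identity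
`of : K_v ≃+* K`), and let `ψ, ψ' ∈ Real.ind1StripOf v L` — elements of print's (Ind1) strip part at `v`, i.e. realised
lifts of automorphisms of the `𝒟⊢`-prime-strip `G_v` — act on `K` as the transvection pair of a twist datum
`(ya, yb; ca, cb)` over `ℚ_p`: `ψ(x) = x + cb(x)·ya`, `ψ'(x) = x − ca(x)·yb` (BINDERS `hT, hT'`: by Kondo, arXiv:2512.09231
§2 / NSW Thm. 7.5.14 this is the case for the Jannsen–Wingberg twists `φ_i, φ'_i` whenever `p` is odd and
`[K_v : ℚ_p] ≥ 3`).  Then for some `χ ∈ Real.ind1StripOf v L` and some `m ∈ ℤ` the closed ball `B(0, ‖ϖ‖^m) = 𝔪_v^m`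
is NOT mapped onto itself: `χ(𝔪_v^m) ≠ 𝔪_v^m`.  Contrast: print's (Ind2) moves no ball
(`image_closedBall_eq_of_mem_ismIsm`), Dupuy–Hilado's (Ind1) is `{1}`. [claim: Mochizuki2012, status: disputed]
[cite: NeukirchSchmidtWingberg2008, Thm 7.5.14] [cite: DupuyHilado2025, §4.7] -/
theorem exists_mem_ind1StripOf_image_closedBall_ne (hf : v.asIdeal.inertiaDeg ℤ = 1)
    (L : Additive (↥(v.adicCompletionIntegers F))ˣ →+ v.adicCompletion F)
    {ϖ : (RescaledCompletion F p v hv)ˣ} (hϖ : IsUniformizer ϖ)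
    {ca cb : RescaledCompletion F p v hv →ₗ[ℚ_[p]] ℚ_[p]} {ya yb : RescaledCompletion F p v hv}
    (hca : ca ya = 1) (hcb : cb yb = 1) (hba : cb ya = 0)
    {ψ ψ' : v.adicCompletion F ≃+ v.adicCompletion F} (hψ : ψ ∈ ind1StripOf v L) (hψ' : ψ' ∈ ind1StripOf v L)
    (hT : ∀ x : RescaledCompletion F p v hv,
      RescaledCompletion.of F p v hv (ψ ((RescaledCompletion.of F p v hv).symm x)) = x + cb x • ya)
    (hT' : ∀ x : RescaledCompletion F p v hv,
      RescaledCompletion.of F p v hv (ψ' ((RescaledCompletion.of F p v hv).symm x)) = x - ca x • yb) :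
    ∃ χ ∈ ind1StripOf v L, ∃ m : ℤ,
      (fun x => RescaledCompletion.of F p v hv (χ ((RescaledCompletion.of F p v hv).symm x))) ''
          closedBall (0 : RescaledCompletion F p v hv) (‖(ϖ : RescaledCompletion F p v hv)‖ ^ m) ≠
        closedBall (0 : RescaledCompletion F p v hv) (‖(ϖ : RescaledCompletion F p v hv)‖ ^ m) := by
  -- `#(𝒪_v/𝔪_v) = p^{f(v|p)} = p` is prime (abc-iut-S1 `card_residueField`, abc-iut-S7 `residueDegree_rescaledCompletion`)
  have hcard := card_residueField p (RescaledCompletion F p v hv)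
  rw [residueDegree_rescaledCompletion F p v hv, hf, pow_one] at hcard
  obtain ⟨m, hm⟩ := exists_transvection_image_piBall_ne p (K := RescaledCompletion F p v hv)
    (by rw [hcard]; exact Fact.out) hϖ hca hcb hba
    (fun x => RescaledCompletion.of F p v hv (ψ ((RescaledCompletion.of F p v hv).symm x)))
    (fun x => RescaledCompletion.of F p v hv (ψ' ((RescaledCompletion.of F p v hv).symm x))) hT hT'
  rcases hm with h | h
  · exact ⟨ψ, hψ, m, h⟩
  · exact ⟨ψ', hψ', m, h⟩

end Summit.ABC.IUTFork.Thm311.Real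

end
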